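import Literature.NumberTheory.GaloisRepresentations.GaloisCohomologyKummerProofs
import Literature.NumberTheory.GaloisRepresentations.HilbertNinetySubgroup
import Literature.NumberTheory.GaloisRepresentations.GaloisSubgroups
import Literature.NumberTheory.GaloisRepresentations.ConjugationDescent
import HarnessLib

/-!
# Kummer cocycles of the subgroup `Gal(k̄/E) ≤ Γ_k`: `Hom_cont(Gal(k̄/E), μₙ) = Eˣ/Eˣⁿ`, equivariantly
# (cell `b2b-bsdres`, team n1011, row T-EPC = Tate's local Euler–Poincaré characteristic; seat p04 GEN 8; stage C2)

HONEST FRAMING (cell `b2b-bsdres`, run/shared/lean/b2b/bsd-rank1-residual/, verbatim in every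
file): the goal of the cell is to DELETE the COMBINATION-SHAPED residual classes of the
Birch–Swinnerton-Dyer formula for ALL analytic-rank `≤ 1` elliptic curves over `ℚ` — "full BSD
formula for every rank `≤ 1` curve in class `C`" assembled STRICTLY from published theorems — so
that the rank-`≤ 1` remainder becomes exactly the CONSTRUCTION-SHAPED classes, which are TYPED
(missing-input `Prop`s), NOT attempted. This is not "finishing BSD". Team n1011 (N10 / N11, the
additive block X4 ∧ `p = 3`): research route; no claim beyond the stated classes; nothing is
booked; no mark / label is changed by this file. Theorems only (no definition, no named fact, no
`sorry`); TOOL theorems of Galois cohomology.  (Placement: Summits/GaloisImage with the T-EPC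
cone.)

## What

Kummer theory for the open subgroup `N = Gal(k̄/E) ≤ Γ_k` of a subextension `E ⊆ k̄` (the tree's
`galFixing k E`), with values in the tree's discrete module `μₙ = DiscreteGaloisModule.mu k n`
restricted to `N` (Serre, *Local Fields* X §3; *Galois Cohomology* II §1.2): for `α ∈ k̄ˣ` with
`αⁿ` fixed by `N` the map `g ↦ g(α)/α` is a continuous `1`-cocycle of `N` with values in `μₙ`
(`exists_cocycle`), multiplicative in `α` (`muVal_mul`); EVERY continuous cocycle `N → μₙ` is of
this form (`exists_eq_smul_div`, Hilbert 90 for `N` = the tree's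
`subsingleton_one_units_galFixing`); the cocycle of `α` vanishes iff `α` is `N`-fixed, i.e. (in
characteristic `0`, Galois correspondence) iff `α ∈ E` (`forall_smul_div_eq_one_iff_mem`); and the
conjugation action of `g ∈ Γ_k` on cocycles (`(g·φ)(m) = g φ(g⁻¹ m g)`, the tree's
`contOneCocycles.pullback (subgroupConj N g) (conjRepHom _ N g)`) takes the cocycle of `α` to the
cocycle of `g α` (`muVal_conj_pullback`).  Together: `α ↦ (g ↦ g α / α)` induces a `Γ_k`-equivariant
isomorphism `Eˣ/Eˣⁿ ≅ Hom_cont(Gal(k̄/E), μₙ)` when `μₙ ⊆ E` — the input "`H¹(N, ℤ/p) = E^×/E^{×p}`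
as a `G`-module" of Milne's proof of *ADT* I Thm. 2.8 (stage C of the T-EPC programme; the counted
form is the sequel `KummerSubgroupCount`).

References: J.-P. Serre, *Local Fields* (1979), X §3 [SerreLocalFields1979]; J.-P. Serre,
*Galois Cohomology* (1997), II §1.2 [SerreGaloisCohomology1997]; J. S. Milne, *Arithmetic Duality
Theorems* (2006), I §2, proof of Thm. 2.8 [MilneADT2006].
-/

noncomputable section

open CategoryTheory Function Field
open Literature.NumberTheory.GaloisRepresentations
open Literature.NumberTheory.GaloisRepresentations.DiscreteGaloisModule
open Literature.NumberTheory.GaloisRepresentations.LocalWeilDatum (galFixing mem_galFixing_iff)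
open Literature.NumberTheory.EllipticCurves (subgroupConj subgroupConj_apply_coe)

universe u

namespace Summit.BirchSwinnertonDyer.Rank1Residual.GaloisImage

namespace KummerSubgroup

variable (k : Type u) [Field k] (n : ℕ) (E : IntermediateField k (AlgebraicClosure k))

/-- For `g ∈ Gal(k̄/E)` and `α ∈ k̄ˣ` with `αⁿ` fixed by `Gal(k̄/E)`, `g(α)/α` is an `n`-th root of
unity. [cite: SerreLocalFields1979, X §3] -/
theorem smul_div_mem_rootsOfUnity (α : (AlgebraicClosure k)ˣ)
    (hα : ∀ g ∈ galFixing k E, g • α ^ n = α ^ n) (g : galFixing k E) :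
    (g : absoluteGaloisGroup k) • α / α ∈ rootsOfUnity n (AlgebraicClosure k) := by
  rw [mem_rootsOfUnity, div_pow, ← smul_pow', hα g g.2, div_self']

/-- **The Kummer cocycle of `α` on `N = Gal(k̄/E)`**: for `α ∈ k̄ˣ` with `αⁿ` fixed by `N` there is
a continuous `1`-cocycle `φ : N → μₙ` (for the restriction to `N` of the Galois module `μₙ`) with
values `φ(g) = g(α)/α`. [cite: SerreLocalFields1979, X §3] [cite: SerreGaloisCohomology1997, II §1.2] -/
theorem exists_cocycle (α : (AlgebraicClosure k)ˣ) (hα : ∀ g ∈ galFixing k E, g • α ^ n = α ^ n) :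
    ∃ φ : contOneCocycles (subgroupRep (mu k n).toTopRep (galFixing k E)),
      ∀ g : galFixing k E, muVal k n (φ.1 g) = (g : absoluteGaloisGroup k) • α / α := by
  let f : galFixing k E → MuCarrier k n := fun g =>
    MuCarrier.ofRootsOfUnity ⟨(g : absoluteGaloisGroup k) • α / α, smul_div_mem_rootsOfUnity k n E α hα g⟩
  have hf : ∀ g, muVal k n (f g) = (g : absoluteGaloisGroup k) • α / α := fun g => rfl
  have hlc : IsLocallyConstant f := by
    refine IsLocallyConstant.desc _ (muVal k n) ?_ (muVal_injective k n)
    have h1 : IsLocallyConstant fun g : galFixing k E => (g : absoluteGaloisGroup k) • α :=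
      (isLocallyConstant_smul_units k α).comp_continuous continuous_subtype_val
    exact h1.div (IsLocallyConstant.const _)
  refine ⟨⟨⟨f, hlc.continuous⟩, fun g h => muVal_injective k n ?_⟩, fun g => rfl⟩
  change muVal k n (f (g * h)) = muVal k n (f g + (mu k n).toContRepresentation (g : absoluteGaloisGroup k) (f h))
  rw [muVal_add, muVal_toContRepresentation_apply, hf, hf, hf, Subgroup.coe_mul, mul_smul, smul_div']
  rw [mul_comm, div_mul_div_cancel]

/-- Cocycles of `N` with values in `μₙ` are determined by their values in `k̄ˣ`. [folklore] -/
theorem cocycle_eq_of_muVal_eq {φ ψ : contOneCocycles (subgroupRep (mu k n).toTopRep (galFixing k E))}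
    (h : ∀ g, muVal k n (φ.1 g) = muVal k n (ψ.1 g)) : φ = ψ :=
  Subtype.ext (ContinuousMap.ext fun g => muVal_injective k n (h g))

/-- The values `g(αβ)/(αβ) = (g(α)/α)(g(β)/β)`: the Kummer cocycle is multiplicative in `α`.
[cite: SerreLocalFields1979, X §3] -/
theorem smul_div_mul (α β : (AlgebraicClosure k)ˣ) (g : absoluteGaloisGroup k) :
    g • (α * β) / (α * β) = (g • α / α) * (g • β / β) := by
  rw [smul_mul', mul_div_mul_comm]

/-- The values `g(αᵐ)/αᵐ = (g(α)/α)ᵐ`. [folklore] -/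
theorem smul_div_pow (α : (AlgebraicClosure k)ˣ) (g : absoluteGaloisGroup k) (m : ℕ) :
    g • (α ^ m) / α ^ m = (g • α / α) ^ m := by
  rw [smul_pow', div_pow]

/-- **Every continuous cocycle `Gal(k̄/E) → μₙ` is a Kummer cocycle** `g ↦ g(α)/α` with `αⁿ` fixed
by `Gal(k̄/E)`: Hilbert's Theorem 90 for the subgroup (`H¹(Gal(k̄/E), k̄ˣ) = 0`, the tree's
`subsingleton_one_units_galFixing`). [cite: SerreLocalFields1979, X §1 Prop. 2, X §3]
[cite: SerreGaloisCohomology1997, II §1.2 Prop. 1] -/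
theorem exists_eq_smul_div (φ : contOneCocycles (subgroupRep (mu k n).toTopRep (galFixing k E))) :
    ∃ α : (AlgebraicClosure k)ˣ, (∀ g ∈ galFixing k E, g • α ^ n = α ^ n) ∧
      ∀ g : galFixing k E, muVal k n (φ.1 g) = (g : absoluteGaloisGroup k) • α / α := by
  -- the cocycle with values in `k̄ˣ`
  let u : C(galFixing k E, UnitsCarrier k) :=
    ⟨fun g => UnitsCarrier.ofUnits (muVal k n (φ.1 g)),
      (continuous_of_discreteTopology (f := fun v : MuCarrier k n => UnitsCarrier.ofUnits (muVal k n v))).comp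
        φ.1.continuous⟩
  have hu : ∀ g, (UnitsCarrier.toAdditive (u g)).toMul = muVal k n (φ.1 g) := fun g => rfl
  have hmem : u ∈ contOneCocycles (subgroupRep (units k).toTopRep (galFixing k E)) := by
    intro g h
    apply UnitsCarrier.toAdditive.injective
    apply Additive.toMul.injective
    rw [map_add, toMul_add]
    change muVal k n (φ.1 (g * h)) = muVal k n (φ.1 g) *
      (UnitsCarrier.toAdditive (units k (g : absoluteGaloisGroup k) (u h))).toMul
    rw [units_apply_apply, toMul_ofMul, hu, φ.2 g h, muVal_add]
    rfl
  haveI : Subsingleton (continuousCohomology 1 (subgroupRep (units k).toTopRep (galFixing k E))) :=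
    subsingleton_one_units_galFixing (k := k) E
  have h0 : oneCocycleClass (subgroupRep (units k).toTopRep (galFixing k E)) ⟨u, hmem⟩ = 0 :=
    Subsingleton.elim _ _
  obtain ⟨v, hv⟩ := (oneCocycleClass_eq_zero_iff _ _).1 h0
  refine ⟨(UnitsCarrier.toAdditive v).toMul, fun g hg => ?_, fun g => ?_⟩
  · -- `g αⁿ = (g α)ⁿ = (φ(g) α)ⁿ = αⁿ`
    have h := hv ⟨g, hg⟩
    have h' : muVal k n (φ.1 ⟨g, hg⟩) = g • (UnitsCarrier.toAdditive v).toMul / (UnitsCarrier.toAdditive v).toMul := by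
      have := congrArg (fun w => (UnitsCarrier.toAdditive w).toMul) h
      simpa [hu, toMul_sub] using this
    have hpow : (g • (UnitsCarrier.toAdditive v).toMul / (UnitsCarrier.toAdditive v).toMul) ^ n = 1 := by
      rw [← h', muVal_pow_eq_one]
    rw [div_pow, ← smul_pow', div_eq_one] at hpow
    exact hpow
  · have h := hv g
    have := congrArg (fun w => (UnitsCarrier.toAdditive w).toMul) h
    simpa [hu, toMul_sub] using this

/-- `α ∈ k̄ˣ` has trivial Kummer cocycle on `Gal(k̄/E)` iff it is fixed by `Gal(k̄/E)`. [folklore] -/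
theorem forall_smul_div_eq_one_iff (α : (AlgebraicClosure k)ˣ) :
    (∀ g : galFixing k E, (g : absoluteGaloisGroup k) • α / α = 1) ↔
      ∀ g ∈ galFixing k E, g • (α : AlgebraicClosure k) = α := by
  constructor
  · intro h g hg
    have h1 := h ⟨g, hg⟩
    rw [div_eq_one] at h1
    have := congrArg Units.val h1
    rwa [Units.coe_smul] at this
  · intro h g
    rw [div_eq_one]
    exact Units.ext (by rw [Units.coe_smul]; exact h g g.2)

/-- **Galois correspondence** (characteristic `0`): `α ∈ k̄` is fixed by `Gal(k̄/E)` iff `α ∈ E`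
(Mathlib `InfiniteGalois.fixedField_fixingSubgroup`). [folklore] -/
theorem forall_smul_eq_iff_mem [CharZero k] (x : AlgebraicClosure k) :
    (∀ g ∈ galFixing k E, g • x = x) ↔ x ∈ E := by
  constructor
  · intro h
    rw [← InfiniteGalois.fixedField_fixingSubgroup E, IntermediateField.mem_fixedField_iff]
    intro σ hσ
    have hmem : (Field.absoluteGaloisGroup.toAlgEquiv k).symm σ ∈ galFixing k E := by
      rw [mem_galFixing_iff]
      intro y hy
      rw [Field.absoluteGaloisGroup.smul_def, MulEquiv.apply_symm_apply]
      exact (IntermediateField.mem_fixingSubgroup_iff _ _).1 hσ y hy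
    have := h _ hmem
    rwa [Field.absoluteGaloisGroup.smul_def, MulEquiv.apply_symm_apply] at this
  · intro hx g hg
    exact (mem_galFixing_iff k).1 hg x hx

/-- **Triviality of the Kummer cocycle** (characteristic `0`): the cocycle `g ↦ g(α)/α` of
`Gal(k̄/E)` vanishes iff `α ∈ E`. [cite: SerreLocalFields1979, X §3] -/
theorem forall_smul_div_eq_one_iff_mem [CharZero k] (α : (AlgebraicClosure k)ˣ) :
    (∀ g : galFixing k E, (g : absoluteGaloisGroup k) • α / α = 1) ↔ (α : AlgebraicClosure k) ∈ E := by
  rw [forall_smul_div_eq_one_iff, forall_smul_eq_iff_mem]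

/-- For `E/k` normal, `g ∈ Γ_k` and `α` with `αⁿ` fixed by `Gal(k̄/E)`, also `(gα)ⁿ` is fixed by
`Gal(k̄/E)`. [folklore] -/
theorem smul_pow_fixed [(galFixing k E).Normal] (α : (AlgebraicClosure k)ˣ)
    (hα : ∀ g ∈ galFixing k E, g • α ^ n = α ^ n) (g : absoluteGaloisGroup k) :
    ∀ m ∈ galFixing k E, m • (g • α) ^ n = (g • α) ^ n := by
  intro m hm
  have hconj : g⁻¹ * m * g ∈ galFixing k E := by
    have := Subgroup.Normal.conj_mem inferInstance m hm g⁻¹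
    rwa [inv_inv] at this
  rw [← smul_pow', ← mul_smul]
  have : m * g = g * (g⁻¹ * m * g) := by group
  rw [this, mul_smul, hα _ hconj]

/-- **Equivariance of the Kummer cocycles**: for `E/k` normal and `g ∈ Γ_k`, the conjugate
`(g·φ)(m) = g φ(g⁻¹ m g)` of a cocycle `φ` of `Gal(k̄/E)` with values `m(α)/α` has values
`m(gα)/(gα)` — `Eˣ/Eˣⁿ ≅ Hom_cont(Gal(k̄/E), μₙ)` is `Gal(E/k)`-equivariant.
[cite: MilneADT2006, I §2 proof of Thm 2.8] [cite: SerreLocalFields1979, X §3] -/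
theorem muVal_conj_pullback [(galFixing k E).Normal]
    (φ : contOneCocycles (subgroupRep (mu k n).toTopRep (galFixing k E)))
    (α : (AlgebraicClosure k)ˣ)
    (hφ : ∀ m : galFixing k E, muVal k n (φ.1 m) = (m : absoluteGaloisGroup k) • α / α)
    (g : absoluteGaloisGroup k) (m : galFixing k E) :
    muVal k n ((contOneCocycles.pullback (subgroupConj (galFixing k E) g)
      (conjRepHom (mu k n).toTopRep (galFixing k E) g) φ).1 m) =
      (m : absoluteGaloisGroup k) • (g • α) / (g • α) := by
  rw [conj_pullback_apply]
  change muVal k n (mu k n g (φ.1 (subgroupConj (galFixing k E) g m))) = _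
  rw [muVal_apply, hφ, subgroupConj_apply_coe, smul_div', ← mul_smul, ← mul_smul]
  congr 1
  rw [← mul_assoc, ← mul_assoc, mul_inv_cancel, one_mul]

end KummerSubgroup

end Summit.BirchSwinnertonDyer.Rank1Residual.GaloisImage

end
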